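import Literature.NumberTheory.EllipticCurves.IwasawaSelmerControlCokerProofs
import Literature.NumberTheory.EllipticCurves.H1CorestrictionIndexTwo
import Literature.NumberTheory.EllipticCurves.IwasawaTwistModP
import Literature.NumberTheory.GaloisRepresentations.GaloisCohomology
import Mathlib.RepresentationTheory.Basic
import HarnessLib

/-!
# Crux `KatoDivisibilityX9` (stmt-BirchSwinnertonDyer-20547), line `graded_euler_loss`, stub
# `stub_testCocyclePkLevelX9` (g5 wave 2), part 1: the inflation–restriction dictionary
# `H¹(K, M ⊗ Λ/(p^k, T^L)(κ⁻¹)) ≅ H¹(K_∞, M)[(conj_γ − 1)^L]` ON COCYCLES (any torsion level)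

Seat `bsd-line-k6-p4` (prover-bsd-line-k6-p4-g5-0, stub worker A).  THEOREMS ONLY (no definition, no
named fact, no `sorry`); `--supports stmt-BirchSwinnertonDyer-20547` helper; closes nothing.

This is the level-`p^k` replacement of the tree's (k = 1, lossy for k ≥ 2) inverse-Shapiro dictionary
`coresShapiroPk`, done WITHOUT Shapiro's lemma, group rings or corestriction: for a `ℤ_p`-extension
`κ` of a field `K` (char. 0) with topological generator `γ` (`κ γ = 1`), `Γ_∞ = ker κ = Gal(K̄/K_∞)`, a
discrete `Γ_K`-module `M` and ANY discrete Galois module `X` on `Fin L → M` such that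

* (hX)  `Γ_∞` acts coordinatewise: `X τ x = (τ • x_i)_i` for `τ ∈ Γ_∞`;
* (hγ)  `γ` acts by `(1+S)^{-1}` after the coordinatewise action: `X γ x + S (X γ x) = (γ • x_i)_i`
  (`S = shiftEnd M L` = multiplication by `T`),

— e.g. `X = M ⊗ (ℤ/p^k)[T]/(T^L)(χ_κ^{-1})` = `κ.invTwist.twistModPk ρ hM L` / `κ.invTwist.twistModP ρ hM L`
(next files) — we prove, entirely on continuous cocycles:

* `exists_coordCocycle` — the coordinates `τ ↦ ψ(τ)_i` of a cocycle `ψ ∈ Z¹(Γ_K, X)` restricted to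
  `Γ_∞` are cocycles of `M` (the maps `r_i : H¹(K, X) → H¹(K_∞, M)`).
* `conjH1_sub_coordClass` / `conjH1_coordClass_zero` — **`T ↔ conj_γ − 1` on the nose**:
  `(conj_γ − 1)[ψ_{i+1}|_{Γ_∞}] = [ψ_i|_{Γ_∞}]` and `(conj_γ − 1)[ψ_0|_{Γ_∞}] = 0` (cocycle identity
  `X(γ)ψ(γ⁻¹τγ) − ψ(τ) = (X(τ) − 1)ψ(γ)`).
* `oneCocycleClass_eq_zero_of_topCoord` — **injectivity**: if `M^{Γ_∞} = 0`, a cocycle whose top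
  coordinate restricts to a coboundary on `Γ_∞` is a coboundary (inflation–restriction, Serre I §2.6,
  proved by hand: all coordinates die by the previous item, then `ψ − ∂v` vanishes on `Γ_∞` and takes
  `Γ_∞`-invariant values).
* (sequel file `…StubTestCocyclePkLevelX9InfResSurj`) surjectivity onto the `(conj_γ − 1)^L`-torsion
  by Greenberg's Lemma 3.2 (`cd ℤ_p = 1`, the tree's `ZpExtension.exists_extend` at layer `0`).

Design: `X` is abstract (hypotheses (hX), (hγ)), so the same file serves `E[p]` (`modPTwist`) and
`E[p^k]` (`modPkTwist`, any `k`); everything is stated on cocycles (no new definition).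

References: J.-P. Serre, *Galois Cohomology* (1997) I §2.6 (b) (inflation–restriction) [SerreGaloisCohomology1997];
R. Greenberg, LNM 1716 (1999) §3 Lemma 3.2 [GreenbergLNM1716]; J. Neukirch, A. Schmidt, K. Wingberg (2008)
(1.6.4)–(1.6.6) [NeukirchSchmidtWingberg2008]; L. Washington (1997) §13.1–13.2 (`T = γ − 1`) [Washington1997].
-/

set_option autoImplicit false
-- the summit and its single problem are both named `BirchSwinnertonDyer` (registry layout D-0017)
set_option linter.dupNamespace false

noncomputable section

open scoped ContRepresentation
open Field Literature.NumberTheory.GaloisRepresentations Literature.NumberTheory.EllipticCurves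

universe u

namespace Summit.BirchSwinnertonDyer.BirchSwinnertonDyer.Theorems.OneSidedTwistSqueezeX9KatoDivisibilityX9StubTestCocyclePkLevelX9InfRes

/-! ## The shift: `1 + S` is injective -/

section Shift

variable {M : Type u} [AddCommGroup M] {L : ℕ}

/-- `1 + S` is injective on `Fin L → M` (it is unipotent): `x + Sx = 0 ⟹ x = 0`, read off coordinate
by coordinate from the bottom. [cite: Washington1997, §13.1–§13.2] -/
theorem eq_zero_of_add_shiftEnd_eq_zero (x : Fin L → M) (h : x + shiftEnd M L x = 0) : x = 0 := by
  have key : ∀ n : ℕ, ∀ i : Fin L, (i : ℕ) = n → x i = 0 := by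
    intro n
    induction n with
    | zero =>
      intro i hi
      have hi0 := congrFun h i
      rw [Pi.add_apply, shiftEnd_apply, dif_pos hi, add_zero] at hi0
      exact hi0
    | succ n ih =>
      intro i hi
      have hi0 := congrFun h i
      rw [Pi.add_apply, shiftEnd_apply, dif_neg (by omega), ih ⟨(i : ℕ) - 1, by omega⟩ (by simp [hi]),
        add_zero] at hi0
      exact hi0
  funext i
  exact key i i rfl

/-- The shift commutes with a coordinatewise scalar (e.g. a Galois element acting on `M`):
`S (g • x) = g • (S x)`. [cite: Washington1997, §13.1–§13.2] -/
theorem shiftEnd_smul {G : Type*} [SMul G M] (g : G) (hg : g • (0 : M) = 0) (x : Fin L → M) :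
    shiftEnd M L (fun i => g • x i) = fun i => g • shiftEnd M L x i := by
  funext i
  simp only [shiftEnd_apply]
  by_cases h : (i : ℕ) = 0
  · rw [dif_pos h, dif_pos h, hg]
  · rw [dif_neg h, dif_neg h]

end Shift

/-! ## The dictionary on cocycles -/

section Dictionary

variable {K : Type u} [Field K] {p : ℕ} [Fact p.Prime] (κ : ZpExtension K p)
variable {M : Type u} [AddCommGroup M] [DistribMulAction (absoluteGaloisGroup K) M]
  [TopologicalSpace M] [DiscreteTopology M]
variable {L : ℕ} (X : DiscreteGaloisModule K (Fin L → M))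

/-- **The coordinate cocycles `τ ↦ ψ(τ)_i` on `Γ_∞`.**  If `Γ_∞ = ker κ` acts on `X` coordinatewise
(hX), the `i`-th coordinate of a cocycle `ψ ∈ Z¹(Γ_K, X)` restricted to `Γ_∞` is a cocycle with values
in `M` — the restriction `H¹(K, X) → H¹(K_∞, X) = H¹(K_∞, M)^L` followed by the `i`-th projection.
[cite: SerreGaloisCohomology1997, I §2.6] -/
theorem exists_coordCocycle
    (hX : ∀ τ ∈ κ.kerSubgroup, ∀ x : Fin L → M, X τ x = fun i => τ • x i)
    (ψ : contOneCocycles X.toTopRep) (i : Fin L) :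
    ∃ e : contOneCocycles (discreteTopRep κ.kerSubgroup M),
      ∀ τ : κ.kerSubgroup, e.1 τ = ψ.1 (τ : absoluteGaloisGroup K) i := by
  refine ⟨⟨⟨fun τ => ψ.1 (τ : absoluteGaloisGroup K) i,
    (continuous_apply i).comp (ψ.1.continuous.comp continuous_subtype_val)⟩, fun τ σ => ?_⟩,
    fun τ => rfl⟩
  change ψ.1 ((τ : absoluteGaloisGroup K) * σ) i =
    ψ.1 (τ : absoluteGaloisGroup K) i + (τ : absoluteGaloisGroup K) • ψ.1 (σ : absoluteGaloisGroup K) i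
  rw [ψ.2 (τ : absoluteGaloisGroup K) σ, Pi.add_apply]
  congr 1
  change (X (τ : absoluteGaloisGroup K) (ψ.1 (σ : absoluteGaloisGroup K))) i = _
  rw [hX _ τ.2]

/-- The pointwise identity behind `T ↔ conj_γ − 1`: for a cocycle `ψ ∈ Z¹(Γ_K, X)`, `τ ∈ Γ_∞` and the
twisted action (hX)/(hγ), `γ • ψ(γ⁻¹τγ)_i = ψ(τ)_i + (Sψ(τ))_i + (τ • w_i − w_i)` with
`w = (1+S)(ψ γ)` — i.e. `conj_γ` of the coordinate vector is `(1+S)` of it, up to a coboundary.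
[cite: SerreGaloisCohomology1997, I §2.6] -/
theorem smul_apply_conj_eq
    (hX : ∀ τ ∈ κ.kerSubgroup, ∀ x : Fin L → M, X τ x = fun i => τ • x i)
    {γ : absoluteGaloisGroup K}
    (hγS : ∀ x : Fin L → M, X γ x + shiftEnd M L (X γ x) = fun i => γ • x i)
    (ψ : contOneCocycles X.toTopRep) {τ : absoluteGaloisGroup K} (hτ : τ ∈ κ.kerSubgroup) (i : Fin L) :
    γ • ψ.1 (γ⁻¹ * τ * γ) i =
      ψ.1 τ i + shiftEnd M L (ψ.1 τ) i +
        (τ • (ψ.1 γ + shiftEnd M L (ψ.1 γ)) i - (ψ.1 γ + shiftEnd M L (ψ.1 γ)) i) := by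
  -- the cocycle identity `X(γ) ψ(γ⁻¹ τ γ) = ψ τ + (X τ − 1) ψ γ`
  have h1 : ψ.1 (γ * γ⁻¹) = ψ.1 γ + X γ (ψ.1 γ⁻¹) := ψ.2 γ γ⁻¹
  rw [mul_inv_cancel, contOneCocycles.apply_one] at h1
  have h2 : ψ.1 (γ⁻¹ * τ * γ) = ψ.1 γ⁻¹ + X γ⁻¹ (ψ.1 (τ * γ)) := by
    rw [mul_assoc]; exact ψ.2 γ⁻¹ (τ * γ)
  have h3 : ψ.1 (τ * γ) = ψ.1 τ + X τ (ψ.1 γ) := ψ.2 τ γ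
  have hz : X γ (ψ.1 (γ⁻¹ * τ * γ)) = ψ.1 τ + (X τ (ψ.1 γ) - ψ.1 γ) := by
    rw [h2, map_add, h3, ← LinearMap.comp_apply, ← Module.End.mul_eq_comp, ← map_mul, mul_inv_cancel,
      map_one, Module.End.one_apply]
    have : X γ (ψ.1 γ⁻¹) = -ψ.1 γ := eq_neg_of_add_eq_zero_right h1.symm
    rw [this]
    abel
  -- apply `(1 + S)` and read coordinate `i`
  have key := hγS (ψ.1 (γ⁻¹ * τ * γ))
  rw [hz] at key
  have hi := congrFun key i
  rw [← hi, hX τ hτ]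
  simp only [Pi.add_apply, Pi.sub_apply, map_add, map_sub, smul_add, shiftEnd_smul τ (smul_zero τ)]
  abel

/-- **`(conj_γ − 1) r_{i+1} = r_i`**: for a cocycle `ψ ∈ Z¹(Γ_K, X)` and cocycles `e, e'` on `Γ_∞` with
`e = ψ_{i+1}|_{Γ_∞}`, `e' = ψ_i|_{Γ_∞}`, one has `conj_γ [e] − [e] = [e']` in `H¹(K_∞, M)` — under the
dictionary, multiplication by `T` (the shift, `i+1 ↦ i` on top-normalised coordinates) is `conj_γ − 1`
EXACTLY (the level-`p^k` twin of the tree's `coresShapiro_invTwist_conj_sub`).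
[cite: SerreGaloisCohomology1997, I §2.6] [cite: Washington1997, §13.1–§13.2] -/
theorem conjH1_sub_coordClass
    (hX : ∀ τ ∈ κ.kerSubgroup, ∀ x : Fin L → M, X τ x = fun i => τ • x i)
    {γ : absoluteGaloisGroup K}
    (hγS : ∀ x : Fin L → M, X γ x + shiftEnd M L (X γ x) = fun i => γ • x i)
    (ψ : contOneCocycles X.toTopRep) (i : Fin L) (hi : (i : ℕ) + 1 < L)
    (e e' : contOneCocycles (discreteTopRep κ.kerSubgroup M))
    (he : ∀ τ : κ.kerSubgroup, e.1 τ = ψ.1 (τ : absoluteGaloisGroup K) ⟨(i : ℕ) + 1, hi⟩)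
    (he' : ∀ τ : κ.kerSubgroup, e'.1 τ = ψ.1 (τ : absoluteGaloisGroup K) i) :
    conjH1 κ.kerSubgroup M γ (oneCocycleClass _ e) - oneCocycleClass _ e = oneCocycleClass _ e' := by
  rw [conjH1_oneCocycleClass, ← oneCocycleClass_sub, ← sub_eq_zero, ← oneCocycleClass_sub,
    oneCocycleClass_eq_zero_iff]
  refine ⟨(ψ.1 γ + shiftEnd M L (ψ.1 γ)) ⟨(i : ℕ) + 1, hi⟩, fun τ => ?_⟩
  change γ • e.1 (subgroupConj κ.kerSubgroup γ τ) - e.1 τ - e'.1 τ =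
    (τ : absoluteGaloisGroup K) • (ψ.1 γ + shiftEnd M L (ψ.1 γ)) ⟨(i : ℕ) + 1, hi⟩ -
      (ψ.1 γ + shiftEnd M L (ψ.1 γ)) ⟨(i : ℕ) + 1, hi⟩
  rw [he, he, he', subgroupConj_apply_coe, smul_apply_conj_eq κ X hX hγS ψ τ.2]
  have hS : shiftEnd M L (ψ.1 (τ : absoluteGaloisGroup K)) ⟨(i : ℕ) + 1, hi⟩ =
      ψ.1 (τ : absoluteGaloisGroup K) i := by
    rw [shiftEnd_apply, dif_neg (by simp)]
    congr 1
  rw [hS]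
  abel

/-- **`(conj_γ − 1) r_0 = 0`**: the constant coordinate of `ψ|_{Γ_∞}` is `conj_γ`-invariant in
`H¹(K_∞, M)` (`T · T^{L−1} = 0`). [cite: SerreGaloisCohomology1997, I §2.6] -/
theorem conjH1_coordClass_zero
    (hX : ∀ τ ∈ κ.kerSubgroup, ∀ x : Fin L → M, X τ x = fun i => τ • x i)
    {γ : absoluteGaloisGroup K}
    (hγS : ∀ x : Fin L → M, X γ x + shiftEnd M L (X γ x) = fun i => γ • x i)
    (ψ : contOneCocycles X.toTopRep) (hL : 0 < L)
    (e : contOneCocycles (discreteTopRep κ.kerSubgroup M))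
    (he : ∀ τ : κ.kerSubgroup, e.1 τ = ψ.1 (τ : absoluteGaloisGroup K) ⟨0, hL⟩) :
    conjH1 κ.kerSubgroup M γ (oneCocycleClass _ e) - oneCocycleClass _ e = 0 := by
  rw [conjH1_oneCocycleClass, ← oneCocycleClass_sub, oneCocycleClass_eq_zero_iff]
  refine ⟨(ψ.1 γ + shiftEnd M L (ψ.1 γ)) ⟨0, hL⟩, fun τ => ?_⟩
  change γ • e.1 (subgroupConj κ.kerSubgroup γ τ) - e.1 τ =
    (τ : absoluteGaloisGroup K) • (ψ.1 γ + shiftEnd M L (ψ.1 γ)) ⟨0, hL⟩ -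
      (ψ.1 γ + shiftEnd M L (ψ.1 γ)) ⟨0, hL⟩
  rw [he, he, subgroupConj_apply_coe, smul_apply_conj_eq κ X hX hγS ψ τ.2]
  have hS : shiftEnd M L (ψ.1 (τ : absoluteGaloisGroup K)) ⟨0, hL⟩ = 0 := by
    rw [shiftEnd_apply, dif_pos rfl]
  rw [hS]
  abel

/-- **Injectivity of the dictionary (inflation–restriction with `M^{Γ_∞} = 0`).**  If no non-zero
element of `M` is fixed by `Γ_∞`, a cocycle `ψ ∈ Z¹(Γ_K, X)` whose TOP coordinate restricted to `Γ_∞`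
is a coboundary is itself a coboundary: `[ψ] = 0` in `H¹(K, X)`.  (All coordinates die by
`conjH1_sub_coordClass`; then `ψ − ∂v` vanishes on the normal subgroup `Γ_∞`, so its values are
`Γ_∞`-fixed, hence `0`.) [cite: SerreGaloisCohomology1997, I §2.6 (b)] -/
theorem oneCocycleClass_eq_zero_of_topCoord
    (hX : ∀ τ ∈ κ.kerSubgroup, ∀ x : Fin L → M, X τ x = fun i => τ • x i)
    {γ : absoluteGaloisGroup K}
    (hγS : ∀ x : Fin L → M, X γ x + shiftEnd M L (X γ x) = fun i => γ • x i)
    (hM0 : ∀ m : M, (∀ τ ∈ κ.kerSubgroup, τ • m = m) → m = 0)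
    (hL : 0 < L) (ψ : contOneCocycles X.toTopRep)
    (htop : ∃ v : M, ∀ τ ∈ κ.kerSubgroup, ψ.1 τ ⟨L - 1, Nat.sub_lt hL Nat.one_pos⟩ = τ • v - v) :
    oneCocycleClass X.toTopRep ψ = 0 := by
  -- every coordinate restricted to `Γ_∞` is a coboundary
  have hall : ∀ n : ℕ, ∀ i : Fin L, (i : ℕ) + n = L - 1 →
      ∃ v : M, ∀ τ ∈ κ.kerSubgroup, ψ.1 τ i = τ • v - v := by
    intro n
    induction n with
    | zero =>
      intro i hi
      have : i = ⟨L - 1, Nat.sub_lt hL Nat.one_pos⟩ := Fin.ext (by simpa using hi)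
      rw [this]
      exact htop
    | succ n ih =>
      intro i hi
      have hi1 : (i : ℕ) + 1 < L := by omega
      obtain ⟨v, hv⟩ := ih ⟨(i : ℕ) + 1, hi1⟩ (by simp; omega)
      obtain ⟨e, he⟩ := exists_coordCocycle κ X hX ψ ⟨(i : ℕ) + 1, hi1⟩
      obtain ⟨e', he'⟩ := exists_coordCocycle κ X hX ψ i
      have hcl := conjH1_sub_coordClass κ X hX hγS ψ i hi1 e e' he he'
      have he0 : oneCocycleClass _ e = 0 := by
        rw [oneCocycleClass_eq_zero_iff]
        exact ⟨v, fun τ => by rw [he]; exact hv τ τ.2⟩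
      rw [he0, map_zero, sub_zero] at hcl
      obtain ⟨v', hv'⟩ := (oneCocycleClass_eq_zero_iff _ _).1 hcl.symm
      exact ⟨v', fun τ hτ => by rw [← he' ⟨τ, hτ⟩]; exact hv' ⟨τ, hτ⟩⟩
  have hcoord : ∀ i : Fin L, ∃ v : M, ∀ τ ∈ κ.kerSubgroup, ψ.1 τ i = τ • v - v :=
    fun i => hall (L - 1 - i) i (by omega)
  choose v hv using hcoord
  -- `ψ − ∂v` vanishes on `Γ_∞`
  have hψ : ∀ τ ∈ κ.kerSubgroup, ψ.1 τ = X τ v - v := by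
    intro τ hτ
    rw [hX τ hτ]
    funext i
    rw [hv i τ hτ]
    rfl
  -- the cocycle `d = ψ − ∂v` and its cocycle identity
  have hdcoc : ∀ a b : absoluteGaloisGroup K,
      ψ.1 (a * b) - (X (a * b) v - v) = (ψ.1 a - (X a v - v)) + X a (ψ.1 b - (X b v - v)) := by
    intro a b
    rw [ψ.2 a b, map_mul, Module.End.mul_apply, map_sub, map_sub]
    change ψ.1 a + X a (ψ.1 b) - (X a (X b v) - v) = _
    abel
  have hd0 : ∀ τ ∈ κ.kerSubgroup, ψ.1 τ - (X τ v - v) = 0 := fun τ hτ => by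
    rw [hψ τ hτ, sub_self]
  -- hence its values are `Γ_∞`-fixed, hence zero
  have hd : ∀ g : absoluteGaloisGroup K, ψ.1 g - (X g v - v) = 0 := by
    intro g
    have hfix : ∀ τ ∈ κ.kerSubgroup, X τ (ψ.1 g - (X g v - v)) = ψ.1 g - (X g v - v) := by
      intro τ hτ
      have hτ' : g⁻¹ * τ * g ∈ κ.kerSubgroup := by
        simpa using Subgroup.Normal.conj_mem inferInstance τ hτ g⁻¹
      have h1 := hdcoc τ g
      rw [hd0 τ hτ, zero_add] at h1
      have h2 := hdcoc g (g⁻¹ * τ * g)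
      rw [hd0 _ hτ', map_zero, add_zero, show g * (g⁻¹ * τ * g) = τ * g by group] at h2
      rw [← h1, ← h2]
    funext i
    have hi := hM0 ((ψ.1 g - (X g v - v)) i) fun τ hτ => by
      have := congrFun (hfix τ hτ) i
      rw [hX τ hτ] at this
      exact this
    exact hi
  rw [oneCocycleClass_eq_zero_iff]
  exact ⟨v, fun g => sub_eq_zero.1 (hd g)⟩

end Dictionary

end Summit.BirchSwinnertonDyer.BirchSwinnertonDyer.Theorems.OneSidedTwistSqueezeX9KatoDivisibilityX9StubTestCocyclePkLevelX9InfRes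

end
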